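import Literature.Topology.FourManifolds.BoundarySliceMorseData
import Literature.Topology.FourManifolds.BallGluingCharts
import Literature.Topology.FourManifolds.TrisectionsSectorAtlas
import Literature.Topology.FourManifolds.SeamBicollar
import Mathlib.Geometry.Manifold.Immersion
import HarnessLib

/-!
# Boundary slice charts of a face of a trisection from its handlebody embedding

Topic `Literature/Topology/FourManifolds`; infrastructure for the fact seat
`provefact-Literature.Topology.FourManifolds.exists-14560f9fc8` (named fact (c′)
`Literature.Topology.FourManifolds.exists_stabilized_gkTrisection`, Gay–Kirby 2016, Def. 8 and
Lemma 10; here the faces `H_{ab} = S a ∩ S b` of clause (iii) of Def. 1).  Everything in this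
file is **proved**; no definitions, no named facts.

**Theorem (`exists_boundarySliceChart_of_isImmersionAt`).**  *Let `e : H → X` be a topological
embedding of a `3`-manifold with boundary into a `4`-manifold without boundary which is a
`C^∞` immersion at `w`.  For every open `V ∋ e w` there is a boundary slice chart
(`Literature.Topology.FourManifolds.BoundarySliceChart 2 (range e)`: a local diffeomorphism
`Θ` of `X` into `ℝ⁴` with `q ∈ e(H) ↔ (Θ q)₃ = 0 ∧ 0 ≤ (Θ q)₀`) at `e w` with source in `V`,
in which moreover `(Θ (e w'))₀ = 0` exactly for the boundary points `w'` of `H`.*  In the charts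
of Mathlib's `Manifold.IsImmersionAt` the map reads `u ↦ L (u, 0)` for a linear isomorphism
`L : ℝ³ × F ≃ ℝ⁴`; the complement `F` is a line, and `Θ = snoc ∘ (id × ι) ∘ L⁻¹ ∘ ψ`
(`ι : F ≃ ℝ`).  This is the face analogue of `exists_halfSliceChart_of_isImmersionAt`
(`TrisectionsSectorRestructure.lean`).

## References

* J. M. Lee, *Introduction to Smooth Manifolds* (2013), Thm. 5.51 and Thm. 4.12 (rank theorem
  normal form of an immersion). [LeeSmoothManifolds2013]
* D. Gay, R. Kirby, *Trisecting 4-manifolds*, Geom. Topol. 20 (2016), Def. 1. [GayKirby2016]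
-/

open scoped Manifold ContDiff Topology
open Set Function Filter

noncomputable section

namespace Literature.Topology.FourManifolds

universe u

section FaceChart

variable {X : Type u} [TopologicalSpace X] [ChartedSpace (EuclideanSpace ℝ (Fin 4)) X]
  {H : Type u} [TopologicalSpace H] [ChartedSpace (EuclideanHalfSpace 3) H]
  [IsManifold (𝓡∂ 3) ∞ H]

/-- **Boundary slice charts of the image of an embedded `3`-manifold with boundary at an
immersion point.**  See the module docstring. [cite: LeeSmoothManifolds2013, Thm. 5.51] -/
theorem exists_boundarySliceChart_of_isImmersionAt {e : H → X} (he : Topology.IsEmbedding e)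
    {Q : Set X} (hQ : range e = Q)
    {w : H} (himm : Manifold.IsImmersionAt (𝓡∂ 3) (𝓡 4) ∞ e w) {V : Set X} (hV : IsOpen V)
    (hwV : e w ∈ V) :
    ∃ (D : BoundarySliceChart 2 Q) (φ : OpenPartialHomeomorph H (EuclideanHalfSpace 3)),
      φ ∈ IsManifold.maximalAtlas (𝓡∂ 3) ∞ H ∧ e w ∈ D.Θ.source ∧ D.Θ.source ⊆ V ∧
      ∀ w', e w' ∈ D.Θ.source → w' ∈ φ.source ∧
        (D.Θ (e w') 0 = 0 ↔ (𝓡∂ 3).IsBoundaryPoint w') ∧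
        dropLast 2 (D.Θ (e w')) = φ.extend (𝓡∂ 3) w' := by
  subst hQ
  obtain ⟨F, _, _, h⟩ := himm
  set φ := h.domChart with hφ
  set ψ := h.codChart with hψ
  have hwφ : w ∈ φ.source := h.mem_domChart_source
  have hφmem : φ ∈ IsManifold.maximalAtlas (𝓡∂ 3) ∞ H := h.domChart_mem_maximalAtlas
  have hψmem : ψ ∈ IsManifold.maximalAtlas (𝓡 4) ∞ X := h.codChart_mem_maximalAtlas
  have hsrc : φ.source ⊆ e ⁻¹' ψ.source := h.source_subset_preimage_source
  have hwritten := h.writtenInCharts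
  rw [← hφ, ← hψ] at hwritten
  -- ### the complement `F` is a line: `ι : F ≃ ℝ`
  haveI : FiniteDimensional ℝ (EuclideanSpace ℝ (Fin 3) × F) :=
    LinearEquiv.finiteDimensional h.equiv.symm.toLinearEquiv
  haveI : FiniteDimensional ℝ F :=
    Module.Finite.of_surjective (LinearMap.snd ℝ (EuclideanSpace ℝ (Fin 3)) F) LinearMap.snd_surjective
  have hrank : Module.finrank ℝ F = Module.finrank ℝ ℝ := by
    have h1 := LinearEquiv.finrank_eq h.equiv.toLinearEquiv
    rw [Module.finrank_prod, finrank_euclideanSpace_fin, finrank_euclideanSpace_fin] at h1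
    rw [Module.finrank_self]
    omega
  set ι : F ≃L[ℝ] ℝ := ContinuousLinearEquiv.ofFinrankEq hrank with hι
  -- ### the linear isomorphism `Le = snoc ∘ (id × ι) ∘ equiv⁻¹` of `ℝ⁴`
  set Le : EuclideanSpace ℝ (Fin 4) ≃L[ℝ] EuclideanSpace ℝ (Fin 4) :=
    (h.equiv.symm.trans ((ContinuousLinearEquiv.refl ℝ (EuclideanSpace ℝ (Fin 3))).prodCongr ι)).trans
      (snocEquiv 3) with hLe
  have hLeapply : ∀ (z : EuclideanSpace ℝ (Fin 3)) (f : F), Le (h.equiv (z, f)) = snocEquiv 3 (z, ι f) := by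
    intro z f
    simp only [hLe, ContinuousLinearEquiv.trans_apply, ContinuousLinearEquiv.symm_apply_apply,
      ContinuousLinearEquiv.prodCongr_apply, ContinuousLinearEquiv.refl_apply]
  have hLe0 : ∀ z : EuclideanSpace ℝ (Fin 3), Le (h.equiv (z, 0)) = snocEquiv 3 (z, 0) := by
    intro z; rw [hLeapply, map_zero]
  -- ### the chart `Θ₀ = Le ∘ ψ`
  set Θ₀ : OpenPartialHomeomorph X (EuclideanSpace ℝ (Fin 4)) :=
    ψ.trans Le.toHomeomorph.toOpenPartialHomeomorph with hΘ₀
  have hΘ₀coe : ∀ q, Θ₀ q = Le (ψ q) := fun q => rfl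
  have hΘ₀symm : ∀ z, Θ₀.symm z = ψ.symm (Le.symm z) := fun z => rfl
  have hΘ₀src : Θ₀.source = ψ.source := by
    rw [hΘ₀, OpenPartialHomeomorph.trans_source]; simp
  -- the written-in-charts identity, unfolded
  have hext_symm : ∀ u, (φ.extend (𝓡∂ 3)).symm u = φ.symm ((𝓡∂ 3).symm u) := fun u => by
    rw [OpenPartialHomeomorph.extend_coe_symm]; rfl
  have hext_tgt : (φ.extend (𝓡∂ 3)).target = (𝓡∂ 3).symm ⁻¹' φ.target ∩ range (𝓡∂ 3) :=
    OpenPartialHomeomorph.extend_target _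
  have hkey : ∀ u ∈ (φ.extend (𝓡∂ 3)).target, ψ (e (φ.symm ((𝓡∂ 3).symm u))) = h.equiv (u, 0) := by
    intro u hu
    have := hwritten hu
    simp only [comp_apply, OpenPartialHomeomorph.extend_coe, modelWithCornersSelf_coe,
      id_eq] at this
    rw [hext_symm] at this
    exact this
  -- the open set `V'` of `ℝ³` with `target = V' ∩ {0 ≤ u 0}`
  set V' : Set (EuclideanSpace ℝ (Fin 3)) := (𝓡∂ 3).symm ⁻¹' φ.target with hV'
  have hV'o : IsOpen V' := φ.open_target.preimage (𝓡∂ 3).continuous_symm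
  have htgt : (φ.extend (𝓡∂ 3)).target = V' ∩ {u | 0 ≤ u 0} := by
    rw [hext_tgt, hV', range_modelWithCornersEuclideanHalfSpace]
  -- the open set `N` of `X` with `e ⁻¹' N = φ.source`
  obtain ⟨N, hNo, hNe⟩ := he.isInducing.isOpen_iff.1 φ.open_source
  -- ### the source and the chart
  set Src : Set X := Θ₀ ⁻¹' (dropLast 2 ⁻¹' V') ∩ N ∩ V with hSrc
  have hcontΘ₀ : ContinuousOn Θ₀ Θ₀.source := Θ₀.continuousOn
  have hSrco : IsOpen (Θ₀.source ∩ Src) := by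
    rw [hSrc, ← inter_assoc, ← inter_assoc]
    exact ((hcontΘ₀.isOpen_inter_preimage Θ₀.open_source
      (hV'o.preimage (dropLast 2).continuous)).inter hNo).inter hV
  set Θ := Θ₀.restrOpen (Θ₀.source ∩ Src) hSrco with hΘ
  have hΘsrc : Θ.source = Θ₀.source ∩ Src := by
    rw [hΘ, OpenPartialHomeomorph.restrOpen_source, ← inter_assoc, inter_self]
  have hΘcoe : ∀ q, Θ q = Le (ψ q) := fun q => rfl
  -- `Θ (e w') = snoc (φ.extend w', 0)` for `w' ∈ φ.source`
  have hΘe : ∀ w' ∈ φ.source, Le (ψ (e w')) = snocEquiv 3 (φ.extend (𝓡∂ 3) w', 0) ∧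
      φ.extend (𝓡∂ 3) w' ∈ (φ.extend (𝓡∂ 3)).target := by
    intro w' hw'
    have hz : φ.extend (𝓡∂ 3) w' ∈ (φ.extend (𝓡∂ 3)).target :=
      (φ.extend (𝓡∂ 3)).map_source (by rw [OpenPartialHomeomorph.extend_source]; exact hw')
    have h1 := hkey _ hz
    have h2 : φ.symm ((𝓡∂ 3).symm (φ.extend (𝓡∂ 3) w')) = w' := by
      rw [← hext_symm]
      exact (φ.extend (𝓡∂ 3)).left_inv (by rw [OpenPartialHomeomorph.extend_source]; exact hw')
    rw [h2] at h1
    exact ⟨by rw [h1, hLe0], hz⟩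
  -- ### smoothness
  have hΘ₀s : ContMDiffOn (𝓡 4) (𝓡 4) ∞ Θ₀ Θ₀.source := by
    rw [hΘ₀src]
    have h1 : ContMDiffOn (𝓡 4) (𝓡 4) ∞ ψ ψ.source := contMDiffOn_of_mem_maximalAtlas hψmem
    have h2 : ContMDiff (𝓡 4) (𝓡 4) ∞ (Le : EuclideanSpace ℝ (Fin 4) → EuclideanSpace ℝ (Fin 4)) :=
      contMDiff_iff_contDiff.2 Le.contDiff
    exact h2.comp_contMDiffOn h1
  have hΘ₀s' : ContMDiffOn (𝓡 4) (𝓡 4) ∞ Θ₀.symm Θ₀.target := by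
    have h1 : ContMDiffOn (𝓡 4) (𝓡 4) ∞ ψ.symm ψ.target := contMDiffOn_symm_of_mem_maximalAtlas hψmem
    have h2 : ContMDiff (𝓡 4) (𝓡 4) ∞ (Le.symm : EuclideanSpace ℝ (Fin 4) → EuclideanSpace ℝ (Fin 4)) :=
      contMDiff_iff_contDiff.2 Le.symm.contDiff
    refine (h1.comp h2.contMDiffOn fun z hz => ?_).congr fun z _ => hΘ₀symm z
    rw [hΘ₀, OpenPartialHomeomorph.trans_target] at hz
    simpa using hz.2
  -- ### the boundary slice chart
  refine ⟨⟨Θ, hΘ₀s.mono (by rw [hΘsrc]; exact inter_subset_left),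
    hΘ₀s'.mono (by intro z hz; exact hz.1), fun q hq => ?_⟩, φ, hφmem, ?_, ?_, ?_⟩
  · -- `q ∈ range e ↔ (Θ q) 3 = 0 ∧ 0 ≤ (Θ q) 0`
    rw [hΘsrc] at hq
    obtain ⟨hqψ, ⟨hqV', hqN⟩, -⟩ := hq
    rw [hΘ₀src] at hqψ
    constructor
    · rintro ⟨w', rfl⟩
      have hw'φ : w' ∈ φ.source := by rw [← hNe]; exact hqN
      obtain ⟨h1, h2⟩ := hΘe w' hw'φ
      rw [hΘcoe, h1]
      rw [htgt] at h2
      refine ⟨?_, ?_⟩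
      · exact snocEquiv_apply_last 3 _
      · rw [snocEquiv_apply_zero]; exact h2.2
    · rintro ⟨hlast, hq0⟩
      set u : EuclideanSpace ℝ (Fin 3) := dropLast 2 (Θ q) with hu
      have hu0 : 0 ≤ u 0 := by rw [hu, dropLast_apply_zero]; exact hq0
      have huV' : u ∈ V' := hqV'
      have hut : u ∈ (φ.extend (𝓡∂ 3)).target := by rw [htgt]; exact ⟨huV', hu0⟩
      have h1 := hkey u hut
      set w' := φ.symm ((𝓡∂ 3).symm u) with hw'
      have hw'φ : w' ∈ φ.source := by
        have := (φ.extend (𝓡∂ 3)).map_target hut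
        rw [OpenPartialHomeomorph.extend_source, hext_symm] at this
        exact this
      have hew' : e w' ∈ ψ.source := hsrc hw'φ
      have h3 : Θ₀ (e w') = Θ₀ q := by
        rw [hΘ₀coe, h1, hLe0, hu]
        exact snocEquiv_dropLast 2 hlast
      have : e w' = q := Θ₀.injOn (by rw [hΘ₀src]; exact hew') (by rw [hΘ₀src]; exact hqψ) h3
      exact ⟨w', this⟩
  · -- `e w ∈ Θ.source`
    show e w ∈ Θ.source
    rw [hΘsrc, hΘ₀src]
    obtain ⟨h1, h2⟩ := hΘe w hwφ
    refine ⟨hsrc hwφ, ⟨?_, by rw [← hNe] at hwφ; exact hwφ⟩, hwV⟩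
    show dropLast 2 (Le (ψ (e w))) ∈ V'
    rw [h1, dropLast_snocEquiv]; rw [htgt] at h2; exact h2.1
  · show Θ.source ⊆ V
    rw [hΘsrc]; exact fun q hq => hq.2.2
  · intro w' hw'
    have hw'src : e w' ∈ Θ.source := hw'
    rw [hΘsrc] at hw'src
    have hw'φ : w' ∈ φ.source := by rw [← hNe]; exact hw'src.2.1.2
    obtain ⟨h1, h2⟩ := hΘe w' hw'φ
    have hcoord : Θ (e w') = snocEquiv 3 (φ.extend (𝓡∂ 3) w', 0) := by rw [hΘcoe, h1]
    refine ⟨hw'φ, ?_, by rw [hcoord, dropLast_snocEquiv]⟩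
    rw [hcoord, snocEquiv_apply_zero]
    -- boundary points in the chart `φ` of the maximal atlas
    rw [(𝓡∂ 3).isBoundaryPoint_iff_not_isInteriorPoint,
      isInteriorPoint_iff_of_mem_maximalAtlas (I := 𝓡∂ 3) (by simp) hφmem hw'φ,
      interior_range_modelWithCornersEuclideanHalfSpace, mem_setOf_eq, not_lt]
    rw [htgt] at h2
    have h0 : 0 ≤ φ.extend (𝓡∂ 3) w' 0 := h2.2
    exact ⟨fun h => h.le, fun h => le_antisymm h h0⟩

/-- **Transport of Morse data from the handlebody to the face** at an interior point.  With the
boundary slice chart `D` and the chart `φ` of `exists_boundarySliceChart_of_isImmersionAt`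
(same coordinates: `dropLast (D.Θ (e w')) = φ.extend w'`), if `G ∘ e = f` on `e ⁻¹ D.Θ.source`
then `w` is critical for `f` iff `⟨e w, _⟩` is critical for `G|Q` (structure `Φ.chartedSpace`
of any boundary slice atlas `Φ` of `Q = range e`), and then nondegeneracy and the index agree:
both are read in charts with the same written function (`MorseChartChangeInterior.lean`).
[cite: Milnor1963, §2; LeeSmoothManifolds2013, Thm. 5.51] -/
theorem morseData_face_transport [IsManifold (𝓡 4) ∞ X] {e : H → X} (he : Continuous e)
    {Q : Set X} (hQ : range e = Q)
    (Φ : BoundarySliceAtlas 2 Q) (D : BoundarySliceChart 2 Q)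
    {φ : OpenPartialHomeomorph H (EuclideanHalfSpace 3)} (hφ : φ ∈ IsManifold.maximalAtlas (𝓡∂ 3) ∞ H)
    {w : H} (hint : (𝓡∂ 3).IsInteriorPoint w) (hew : e w ∈ D.Θ.source)
    (hcoord : ∀ w', e w' ∈ D.Θ.source → w' ∈ φ.source ∧ dropLast 2 (D.Θ (e w')) = φ.extend (𝓡∂ 3) w')
    {f : H → ℝ} (hf : ContMDiff (𝓡∂ 3) 𝓘(ℝ, ℝ) ∞ f) {G : X → ℝ} (hG : ContMDiff (𝓡 4) 𝓘(ℝ, ℝ) ∞ G)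
    (heq : ∀ w', e w' ∈ D.Θ.source → G (e w') = f w') :
    letI := Φ.chartedSpace
    (IsMCriticalPt (𝓡∂ 3) f w ↔
      IsMCriticalPt (𝓡∂ 3) (G ∘ Subtype.val : ↥Q → ℝ) ⟨e w, hQ ▸ mem_range_self w⟩) ∧
    (IsMCriticalPt (𝓡∂ 3) f w →
      ((mhessian (𝓡∂ 3) f w).Nondegenerate ↔
        (mhessian (𝓡∂ 3) (G ∘ Subtype.val : ↥Q → ℝ) ⟨e w, hQ ▸ mem_range_self w⟩).Nondegenerate) ∧
      morseIndex (𝓡∂ 3) f w =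
        morseIndex (𝓡∂ 3) (G ∘ Subtype.val : ↥Q → ℝ) ⟨e w, hQ ▸ mem_range_self w⟩) := by
  letI := Φ.chartedSpace
  haveI := Φ.isManifold
  set p : ↥Q := ⟨e w, hQ ▸ mem_range_self w⟩ with hp
  obtain ⟨hwφ, hcw⟩ := hcoord w hew
  -- the two charts and the common coordinates
  set Dc := D.chart p with hDc
  have hDcmem : Dc ∈ IsManifold.maximalAtlas (𝓡∂ 3) ∞ ↥Q := Φ.chart_mem_maximalAtlas D p
  have hpDc : p ∈ Dc.source := by rw [hDc, D.chart_source]; exact hew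
  set u₀ : EuclideanSpace ℝ (Fin 3) := φ.extend (𝓡∂ 3) w with hu₀
  have hDcp : Dc.extend (𝓡∂ 3) p = u₀ := by
    rw [hDc, D.extend_chart_apply hpDc]; exact hcw
  have hφmem2 : φ ∈ IsManifold.maximalAtlas (𝓡∂ 3) 2 H :=
    IsManifold.maximalAtlas_subset_of_le (M := H) (I := 𝓡∂ 3) ENat.LEInfty.out hφ
  have hDcmem2 : Dc ∈ IsManifold.maximalAtlas (𝓡∂ 3) 2 ↥Q :=
    IsManifold.maximalAtlas_subset_of_le (M := ↥Q) (I := 𝓡∂ 3) ENat.LEInfty.out hDcmem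
  have hDcmem1 : Dc ∈ IsManifold.maximalAtlas (𝓡∂ 3) 1 ↥Q :=
    IsManifold.maximalAtlas_subset_of_le (M := ↥Q) (I := 𝓡∂ 3) (by norm_num) hDcmem
  have hφmem1 : φ ∈ IsManifold.maximalAtlas (𝓡∂ 3) 1 H :=
    IsManifold.maximalAtlas_subset_of_le (M := H) (I := 𝓡∂ 3) (by norm_num) hφ
  -- `u₀` is an interior point of the half-space; `p` is an interior point of `Q`
  have hu₀int : u₀ ∈ interior (range (𝓡∂ 3)) :=
    mem_interior_range_extend_of_mem_maximalAtlas (I := 𝓡∂ 3) (by simp) hφ hwφ hint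
  have hpint : (𝓡∂ 3).IsInteriorPoint p := by
    rw [isInteriorPoint_iff_of_mem_maximalAtlas (I := 𝓡∂ 3) (by simp) hDcmem hpDc, hDcp]
    exact hu₀int
  -- the written functions agree near `u₀`
  set gH : EuclideanSpace ℝ (Fin 3) → ℝ := f ∘ (φ.extend (𝓡∂ 3)).symm with hgH
  set gQ : EuclideanSpace ℝ (Fin 3) → ℝ := (G ∘ Subtype.val : ↥Q → ℝ) ∘ (Dc.extend (𝓡∂ 3)).symm with hgQ
  have hGval : ContMDiff (𝓡∂ 3) 𝓘(ℝ, ℝ) ∞ (G ∘ Subtype.val : ↥Q → ℝ) := hG.comp Φ.contMDiff_subtype_val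
  have hagree : gQ =ᶠ[𝓝 u₀] gH := by
    -- points near `u₀`: in the target of `φ.extend`, with `e (φ⁻¹ u) ∈ D.Θ.source`
    have htgt : (φ.extend (𝓡∂ 3)).target ∈ 𝓝 u₀ := by
      have h := φ.extend_target_mem_nhdsWithin (I := 𝓡∂ 3) hwφ
      rwa [nhdsWithin_eq_nhds.2 (mem_interior_iff_mem_nhds.1 hu₀int)] at h
    have hcont : ContinuousAt (fun u => e ((φ.extend (𝓡∂ 3)).symm u)) u₀ := by
      have h1 : ContinuousAt (φ.extend (𝓡∂ 3)).symm u₀ := by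
        have h := φ.continuousAt_extend_symm (I := 𝓡∂ 3) hwφ
        exact h
      have h2 : ContinuousAt e ((φ.extend (𝓡∂ 3)).symm u₀) := he.continuousAt
      exact h2.comp h1
    have hsrcD : ∀ᶠ u in 𝓝 u₀, e ((φ.extend (𝓡∂ 3)).symm u) ∈ D.Θ.source := by
      apply hcont.preimage_mem_nhds
      have : (φ.extend (𝓡∂ 3)).symm u₀ = w := φ.extend_left_inv (I := 𝓡∂ 3) hwφ
      rw [this]
      exact D.Θ.open_source.mem_nhds hew
    filter_upwards [htgt, hsrcD] with u hu huD
    set w' := (φ.extend (𝓡∂ 3)).symm u with hw'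
    have hφw' : φ.extend (𝓡∂ 3) w' = u := (φ.extend (𝓡∂ 3)).right_inv hu
    obtain ⟨-, hcw'⟩ := hcoord w' huD
    -- `D.Θ (e w') = snoc (u, 0)`
    have heQ : e w' ∈ Q := hQ ▸ mem_range_self w'
    have hlast : D.Θ (e w') (Fin.last 3) = 0 := D.apply_last_eq_zero huD heQ
    have hΘew' : D.Θ (e w') = snocEquiv 3 (u, 0) := by
      rw [← snocEquiv_dropLast 2 hlast, hcw', hφw']
    have hu0 : 0 ≤ u 0 := by
      have := D.apply_zero_nonneg huD heQ
      rwa [hΘew', snocEquiv_apply_zero] at this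
    have hut : snocEquiv 3 (u, 0) ∈ D.Θ.target := by rw [← hΘew']; exact D.Θ.map_source huD
    show G (((Dc.extend (𝓡∂ 3)).symm u).1) = f w'
    rw [hDc, D.coe_extend_chart_symm_of_mem hu0 hut, ← hΘew', D.Θ.left_inv huD, heq w' huD]
  -- ### criticality
  have hcritH : IsMCriticalPt (𝓡∂ 3) f w ↔ fderiv ℝ gH u₀ = 0 :=
    isMCriticalPt_iff_fderiv_comp_extend_symm_eq_zero_of_isInteriorPoint
      ((hf.contMDiffAt (x := w)).of_le ENat.LEInfty.out) hφmem2 hwφ hint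
  have hcritQ : IsMCriticalPt (𝓡∂ 3) (G ∘ Subtype.val : ↥Q → ℝ) p ↔ fderiv ℝ gQ u₀ = 0 := by
    rw [isMCriticalPt_iff_fderiv_comp_extend_symm_eq_zero_of_isInteriorPoint
      ((hGval.contMDiffAt (x := p)).of_le ENat.LEInfty.out) hDcmem2 hpDc hpint, hDcp]
  have hiff : IsMCriticalPt (𝓡∂ 3) f w ↔ IsMCriticalPt (𝓡∂ 3) (G ∘ Subtype.val : ↥Q → ℝ) p := by
    rw [hcritH, hcritQ, hagree.fderiv_eq]
  refine ⟨hiff, fun hcrit => ?_⟩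
  have hcrit' : IsMCriticalPt (𝓡∂ 3) (G ∘ Subtype.val : ↥Q → ℝ) p := hiff.1 hcrit
  -- ### the chart Hessians coincide
  have hHess : hessianInChart (𝓡∂ 3) φ f w = hessianInChart (𝓡∂ 3) Dc (G ∘ Subtype.val : ↥Q → ℝ) p := by
    ext v v'
    rw [hessianInChart_apply_eq_fderiv_fderiv_of_isInteriorPoint (I := 𝓡∂ 3) hφmem1 hwφ hint,
      hessianInChart_apply_eq_fderiv_fderiv_of_isInteriorPoint (I := 𝓡∂ 3) hDcmem1 hpDc hpint, hDcp]
    show fderiv ℝ (fderiv ℝ gH) u₀ v v' = fderiv ℝ (fderiv ℝ gQ) u₀ v v'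
    rw [hagree.fderiv.fderiv_eq]
  have hf2 : ContMDiffAt (𝓡∂ 3) 𝓘(ℝ, ℝ) 2 f w := (hf.contMDiffAt (x := w)).of_le ENat.LEInfty.out
  have hG2 : ContMDiffAt (𝓡∂ 3) 𝓘(ℝ, ℝ) 2 (G ∘ Subtype.val : ↥Q → ℝ) p :=
    (hGval.contMDiffAt (x := p)).of_le ENat.LEInfty.out
  refine ⟨?_, ?_⟩
  · rw [nondegenerate_mhessian_iff_of_isInteriorPoint hf2 hcrit hφmem2 hwφ hint,
      nondegenerate_mhessian_iff_of_isInteriorPoint hG2 hcrit' hDcmem2 hpDc hpint, hHess]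
  · rw [morseIndex_eq_sigNeg_hessianInChart_of_isInteriorPoint hf2 hcrit hφmem2 hwφ hint,
      morseIndex_eq_sigNeg_hessianInChart_of_isInteriorPoint hG2 hcrit' hDcmem2 hpDc hpint, hHess]

/-- **Boundary slice charts of a face at the points of the corner locus, from the corner-slice
charts of the sector**: if in the corner-slice chart `C` (coordinates `(u_a, v_a, t₂, t₃)`) the
face is `{u_a = 0, 0 ≤ v_a}`, then permuting the coordinates to `(v_a, t₂, t₃, u_a)` gives a
boundary slice chart of the face with `0`-th coordinate `v_a` and last coordinate `u_a`.
[cite: LeeSmoothManifolds2013, Thm. 5.51; GayKirby2016, Def. 1] -/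
theorem exists_boundarySliceChart_of_cornerSliceChart {Sa F Q : Set X} {ua va : X → ℝ}
    {ρ : X → X} (C : CornerSliceChart Sa F ua va ρ)
    (hQ : ∀ q ∈ C.Θ.source, q ∈ Q ↔ ua q = 0 ∧ 0 ≤ va q) :
    ∃ D : BoundarySliceChart 2 Q, D.Θ.source = C.Θ.source ∧
      ∀ q, D.Θ q 0 = C.Θ q 1 ∧ D.Θ q 1 = C.Θ q 2 ∧ D.Θ q 2 = C.Θ q 3 ∧
        D.Θ q (Fin.last 3) = C.Θ q 0 := by
  set L : EuclideanSpace ℝ (Fin 4) ≃L[ℝ] EuclideanSpace ℝ (Fin 4) := permCoords (finRotate 4).symm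
    with hL
  have hL' : ∀ (y : EuclideanSpace ℝ (Fin 4)) (i : Fin 4), L y i = y (finRotate 4 i) := by
    intro y i; rw [hL, permCoords_apply, Equiv.symm_symm]
  have h0 : ∀ y : EuclideanSpace ℝ (Fin 4), L y 0 = y 1 := fun y => by rw [hL']; rfl
  have h1 : ∀ y : EuclideanSpace ℝ (Fin 4), L y 1 = y 2 := fun y => by rw [hL']; rfl
  have h2 : ∀ y : EuclideanSpace ℝ (Fin 4), L y 2 = y 3 := fun y => by rw [hL']; rfl
  have h3 : ∀ y : EuclideanSpace ℝ (Fin 4), L y (Fin.last 3) = y 0 := fun y => by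
    rw [show (Fin.last 3 : Fin 4) = 3 from rfl, hL']; rfl
  have hmem : ∀ q ∈ C.Θ.source, q ∈ Q ↔ L (C.Θ q) (Fin.last 3) = 0 ∧ 0 ≤ L (C.Θ q) 0 := by
    intro q hq
    rw [hQ q hq, h3, h0, C.apply_zero q hq, C.apply_one q hq]
  refine ⟨BoundarySliceChart.ofEquiv C.Θ C.contMDiffOn_toFun C.contMDiffOn_symm L hmem,
    BoundarySliceChart.ofEquiv_source _ _ _ _ _, fun q => ?_⟩
  simp only [BoundarySliceChart.ofEquiv_apply]
  exact ⟨h0 _, h1 _, h2 _, h3 _⟩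

/-- **A smooth function on the handlebody extends ambiently near every point of the face**
(Seeley): with `D, φ` as in `exists_boundarySliceChart_of_isImmersionAt`, extend `f` read in
`φ` across the boundary hyperplane of `ℝ³` (`exists_contDiffOn_extension_halfSpace`) and pull
back by the submersion `dropLast ∘ D.Θ`, which restricts to `φ` on the face.
[cite: Seeley1964, Theorem; LeeSmoothManifolds2013, Thm. 5.51] -/
theorem exists_contMDiffOn_extension_face {e : H → X}
    (he : Topology.IsEmbedding e) {w : H} (himm : Manifold.IsImmersionAt (𝓡∂ 3) (𝓡 4) ∞ e w)
    {f : H → ℝ} (hf : ContMDiff (𝓡∂ 3) 𝓘(ℝ, ℝ) ∞ f) :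
    ∃ (N : Set X) (F : X → ℝ), IsOpen N ∧ e w ∈ N ∧ ContMDiffOn (𝓡 4) 𝓘(ℝ, ℝ) ∞ F N ∧
      ∀ w', e w' ∈ N → F (e w') = f w' := by
  obtain ⟨D, φ, hφmem, hewD, -, hD⟩ :=
    exists_boundarySliceChart_of_isImmersionAt he rfl himm isOpen_univ (mem_univ _)
  obtain ⟨hwφ, -, hcw⟩ := hD w hewD
  set V' : Set (EuclideanSpace ℝ (Fin 3)) := (𝓡∂ 3).symm ⁻¹' φ.target with hV'
  have hV'o : IsOpen V' := φ.open_target.preimage (𝓡∂ 3).continuous_symm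
  have htgt : (φ.extend (𝓡∂ 3)).target = V' ∩ {z | 0 ≤ z 0} := by
    rw [OpenPartialHomeomorph.extend_target, hV', range_modelWithCornersEuclideanHalfSpace]
  -- `f` read in `φ`, extended by Seeley
  set g : EuclideanSpace ℝ (Fin 3) → ℝ := f ∘ (φ.extend (𝓡∂ 3)).symm with hg
  have hgs : ContDiffOn ℝ ∞ g (V' ∩ {z | 0 ≤ z 0}) := by
    rw [← htgt]
    have h1 : ContMDiffOn 𝓘(ℝ, EuclideanSpace ℝ (Fin 3)) (𝓡∂ 3) ∞ (φ.extend (𝓡∂ 3)).symm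
        (φ.extend (𝓡∂ 3)).target := by
      rw [OpenPartialHomeomorph.extend_target']
      exact contMDiffOn_extend_symm hφmem
    exact contMDiffOn_iff_contDiffOn.mp (hf.comp_contMDiffOn h1)
  have hmem_tgt : ∀ w' ∈ φ.source, φ.extend (𝓡∂ 3) w' ∈ (φ.extend (𝓡∂ 3)).target := fun w' hw' =>
    (φ.extend (𝓡∂ 3)).map_source (by rw [OpenPartialHomeomorph.extend_source]; exact hw')
  have hz₀ : φ.extend (𝓡∂ 3) w ∈ V' := by
    have := hmem_tgt w hwφ; rw [htgt] at this; exact this.1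
  obtain ⟨V₁, hV₁o, hz₀V₁, -, Gs, hGs, hGg⟩ := exists_contDiffOn_extension_halfSpace hV'o hz₀ hgs
  -- the ambient function `Gs ∘ dropLast ∘ D.Θ`
  set P : X → EuclideanSpace ℝ (Fin 3) := fun q => dropLast 2 (D.Θ q) with hP
  have hPs : ContMDiffOn (𝓡 4) 𝓘(ℝ, EuclideanSpace ℝ (Fin 3)) ∞ P D.Θ.source :=
    (contMDiff_iff_contDiff.2 (dropLast 2).contDiff).comp_contMDiffOn D.contMDiffOn_toFun
  set N : Set X := D.Θ.source ∩ P ⁻¹' V₁ with hN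
  have hNo : IsOpen N := hPs.continuousOn.isOpen_inter_preimage D.Θ.open_source hV₁o
  refine ⟨N, Gs ∘ P, hNo, ⟨hewD, ?_⟩, ?_, fun w' hw' => ?_⟩
  · show dropLast 2 (D.Θ (e w)) ∈ V₁
    rw [hcw]; exact hz₀V₁
  · exact (contMDiffOn_iff_contDiffOn.2 hGs).comp (hPs.mono inter_subset_left) fun q hq => hq.2
  · obtain ⟨hw'D, hw'V₁⟩ := hw'
    obtain ⟨hw'φ, -, hcw'⟩ := hD w' hw'D
    have hmem : φ.extend (𝓡∂ 3) w' ∈ V₁ ∩ {z | 0 ≤ z 0} := by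
      refine ⟨?_, by have := hmem_tgt w' hw'φ; rw [htgt] at this; exact this.2⟩
      have : dropLast 2 (D.Θ (e w')) ∈ V₁ := hw'V₁
      rwa [hcw'] at this
    show Gs (dropLast 2 (D.Θ (e w'))) = f w'
    rw [hcw', hGg hmem, hg, comp_apply]
    congr 1
    exact (φ.extend (𝓡∂ 3)).left_inv (by rw [OpenPartialHomeomorph.extend_source]; exact hw'φ)

end FaceChart

end Literature.Topology.FourManifolds
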